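import Mathlib
import Summits.CriticalPhenomena.CardyFormulaZ2.Theorems.CardySelfRefinementGradientComparabilityOfMonotoneLine
import Summits.CriticalPhenomena.CardyFormulaZ2.Theorems.CardySelfRefinementGradientComparabilityStubLevelSetTransportIntBet
import HarnessLib

/-!
# Crux `GradientComparability` (stmt-CriticalPhenomena-10269), line `monotone-product-coordinates`:
# the composition with the INTEGRATED bet in place of THE BET

Route `CardySelfRefinement`, sub-problem `CriticalPhenomena/CardyFormulaZ2`; vocabulary
(`M`, `P`, `Dρ`, `Dc`, `PathOK`, `ax`, `tb`, …) from `CardySelfRefinementDefs` (definitionally the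
route's `let`-chain).

`GradientComparability_of_monotoneLine` (landed, `…OfMonotoneLine`) closes the crux from the six
registered stubs of the line, the third of which is THE BET (pointwise: `Dρ/Dc` is `Θ`-Lipschitz in
`c` across the level band, `ρ ≤ 1 - δ`).  THE BET enters only through the bulk clause of the
level-set comparability (`stub_levelSetTransport` = `levelSetTransport_bulk` ⊕ `levelSetTransport_corner`),
and that clause already follows from the INTEGRATED bet ∫BET (`levelSetTransport_bulk_of_intBet`,
`…StubLevelSetTransportIntBet`): a mesh-uniform bound on `|∫ ∂_c(Dρ/Dc) dρ|` along the level leaves,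
the statement `stub_intBet` of the sibling line `level-curve-log-slope-identity` — implied by THE BET
and strictly weaker.  `GradientComparability_of_monotoneLineInt` is the same composition with ∫BET as
its third hypothesis: monotone representation → slope bounds → ∫BET → corner BET → corner patch →
window at `ρ = 0` → `GradientComparability`.  Proof verbatim as the landed composition, with
`stub_levelSetTransport hBET hCB hCP` replaced by
`⟨levelSetTransport_bulk_of_intBet hIB …, levelSetTransport_corner hCB hCP …⟩`.
-/

noncomputable section

namespace Summit.CriticalPhenomena.CardyFormulaZ2.Theorems.CardySelfRefinement

open scoped Topology
open Filter Set MeasureTheory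
open Literature.Probability.LatticeModels Literature.Probability.Percolation
open Literature.Probability.Percolation.QuadCrossing
open Summit.CriticalPhenomena.CardyFormulaZ2.Theses.CardySelfRefinement

-- adapted from `GradientComparability_of_monotoneLine` (…Theorems/CardySelfRefinementGradientComparabilityOfMonotoneLine.lean)
/-- **The line `monotone-product-coordinates` from the INTEGRATED bet (registered composition
helper).**  The monotone product representation (`stub_monotoneRep`), the first-order slope bounds
(`stub_slopeBounds`), the INTEGRATED bet ∫BET (the sibling line's `stub_intBet`: a mesh-uniform bound
on `|∫_{ρ₀}^{ρ₁} ∂_c(Dρ/Dc)(ρ, ℓ ρ) dρ|` along every level leaf `ℓ` of the band over `[0, 1-δ]`), the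
corner BET (`stub_cornerBet`), the Kesten patch at the independent corner (`stub_cornerPatch`) and the
Kesten window on the independent slice `ρ = 0` (`stub_windowAtRhoZero`), their signatures inlined
verbatim and in this order, imply the crux `GradientComparability` BY NAME: the slope bounds are
`hSB hMR`, the level-set comparability is `levelSetTransport_bulk_of_intBet hIB` (bulk) with the landed
`levelSetTransport_corner hCB hCP` (corner), `monotoneLine_charts` supplies the two charts,
`MonotoneLine.overlap` glues them into clause (i), and clause (ii) follows from clause (i) at the
endpoint `γ 1 = (0,½)` and `divergesAt_zero_half`. -/
theorem GradientComparability_of_monotoneLineInt :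
    (∀ k : ℕ, ∀ ρ ∈ Set.Icc (0 : ℝ) 1, ∀ c ∈ Set.Icc (0 : ℝ) 1, M k ρ c = (prodBernoulli (fun i :
    Site 2 × Fin 2 × Fin 3 => if i.2.2 = 0 then (if ax k (i.1, i.2.1) then half else Set.projIcc (0
    : ℝ) 1 zero_le_one c) else if i.2.2 = 1 then Set.projIcc (0 : ℝ) 1 zero_le_one (ρ / 2) else
    Set.projIcc (0 : ℝ) 1 zero_le_one ((2 - 2 * ρ) / (2 - ρ)))).map (fun S : Set (Site 2 × Fin 2 ×
    Fin 3) => ({e | ∃ (v : Site 2) (d : Fin 2), e = s(v, v + (if d = 0 then ![1, 0] else ![0, 1])) ∧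
    (if ax k (v, d) then ((tb k (v, d), d, (1 : Fin 3)) ∈ S ∨ ((tb k (v, d), d, (2 : Fin 3)) ∈ S ∧
    (v, d, (0 : Fin 3)) ∈ S)) else (v, d, (0 : Fin 3)) ∈ S)} : BondConfig (Site 2)))) → ((∀ k : ℕ, ∀
    ρ ∈ Set.Icc (0 : ℝ) 1, ∀ c ∈ Set.Icc (0 : ℝ) 1, M k ρ c = (prodBernoulli (fun i : Site 2 × Fin 2
    × Fin 3 => if i.2.2 = 0 then (if ax k (i.1, i.2.1) then half else Set.projIcc (0 : ℝ) 1
    zero_le_one c) else if i.2.2 = 1 then Set.projIcc (0 : ℝ) 1 zero_le_one (ρ / 2) else Set.projIcc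
    (0 : ℝ) 1 zero_le_one ((2 - 2 * ρ) / (2 - ρ)))).map (fun S : Set (Site 2 × Fin 2 × Fin 3) => ({e
    | ∃ (v : Site 2) (d : Fin 2), e = s(v, v + (if d = 0 then ![1, 0] else ![0, 1])) ∧ (if ax k (v,
    d) then ((tb k (v, d), d, (1 : Fin 3)) ∈ S ∨ ((tb k (v, d), d, (2 : Fin 3)) ∈ S ∧ (v, d, (0 :
    Fin 3)) ∈ S)) else (v, d, (0 : Fin 3)) ∈ S)} : BondConfig (Site 2)))) → ∀ k : ℕ, k = 2 ∨ k = 3 →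
    ∀ γ : unitInterval → ℝ × ℝ, PathOK k γ → ∀ (m : ℕ) (F : Fin m → Quad (Set.univ : Set ℂ)), 0 < m
    → (∀ δ : ℝ, 0 < δ → δ ≤ 1 / 2 → ∃ C η₁ : ℝ, 0 < η₁ ∧ ∀ η ∈ Set.Ioo 0 η₁, ∀ s : unitInterval, (γ
    s).1 ≤ 1 - δ → |Dρ k m F η (γ s)| ≤ C * Dc k m F η (γ s)) ∧ (∃ δ : ℝ, 0 < δ ∧ δ ≤ 1 / 4 ∧ ∀ vlo
    vhi : ℝ, 0 < vlo → vlo < vhi → vhi < 1 → ∃ C η₁ : ℝ, 0 < η₁ ∧ ∀ η ∈ Set.Ioo 0 η₁, ∀ ρ ∈ Set.Icc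
    (1 - 2 * δ) 1, ∀ c ∈ Set.Icc (0 : ℝ) 1, P k m F η ρ c ∈ Set.Icc vlo vhi → |Dc k m F η (ρ, c)| ≤
    C * |Dρ k m F η (ρ, c)|)) → (∀ k : ℕ, k = 2 ∨ k = 3 → ∀ (m : ℕ) (F : Fin m → Quad (Set.univ :
    Set ℂ)), 0 < m → ∀ δ : ℝ, 0 < δ → δ ≤ 1 / 2 → ∀ vlo vhi : ℝ, 0 < vlo → vlo < vhi → vhi < 1 → ∃ Θ
    η₁ : ℝ, 0 ≤ Θ ∧ 0 < η₁ ∧ ∀ η ∈ Set.Ioo 0 η₁, ∀ v ∈ Set.Icc vlo vhi, ∀ ℓ : ℝ → ℝ, (∀ ρ ∈ Set.Icc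
    (0 : ℝ) (1 - δ), ℓ ρ ∈ Set.Icc (0 : ℝ) 1 ∧ P k m F η ρ (ℓ ρ) = v) → (∀ ρ ∈ Set.Icc (0 : ℝ) (1 -
    δ), HasDerivWithinAt ℓ (-(Dρ k m F η (ρ, ℓ ρ) / Dc k m F η (ρ, ℓ ρ))) (Set.Icc 0 (1 - δ)) ρ) → ∀
    ρ₀ ∈ Set.Icc (0 : ℝ) (1 - δ), ∀ ρ₁ ∈ Set.Icc (0 : ℝ) (1 - δ), |∫ ρ in ρ₀..ρ₁, derivWithin (fun c
    => Dρ k m F η (ρ, c) / Dc k m F η (ρ, c)) (Set.Icc 0 1) (ℓ ρ)| ≤ Θ) → (∀ k : ℕ, k = 2 ∨ k = 3 →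
    ∀ γ : unitInterval → ℝ × ℝ, PathOK k γ → ∀ (m : ℕ) (F : Fin m → Quad (Set.univ : Set ℂ)), 0 < m
    → ∃ δ : ℝ, 0 < δ ∧ δ ≤ 1 / 4 ∧ ∀ vlo vhi : ℝ, 0 < vlo → vlo < vhi → vhi < 1 → ∃ Θ η₁ : ℝ, 0 ≤ Θ
    ∧ 0 < η₁ ∧ ∀ η ∈ Set.Ioo 0 η₁, ∀ c ∈ Set.Icc (0 : ℝ) 1, ∀ ρ ∈ Set.Icc (1 - 2 * δ) 1, ∀ ρ' ∈
    Set.Icc (1 - 2 * δ) 1, P k m F η ρ c ∈ Set.Icc vlo vhi → P k m F η ρ' c ∈ Set.Icc vlo vhi → Dρ k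
    m F η (ρ, c) ≠ 0 ∧ |Dc k m F η (ρ, c) / Dρ k m F η (ρ, c) - Dc k m F η (ρ', c) / Dρ k m F η (ρ',
    c)| ≤ Θ * |ρ - ρ'|) → (∀ k : ℕ, k = 2 ∨ k = 3 → ∀ (m : ℕ) (F : Fin m → Quad (Set.univ : Set ℂ)),
    0 < m → ∀ vlo vhi : ℝ, 0 < vlo → vlo < vhi → vhi < 1 → ∃ Λ η₁ : ℝ, 0 < η₁ ∧ ∀ η ∈ Set.Ioo 0 η₁,
    ∀ q ∈ Set.Icc (0 : ℝ) 1 ×ˢ Set.Icc (0 : ℝ) 1, ∀ q' ∈ Set.Icc (0 : ℝ) 1 ×ˢ Set.Icc (0 : ℝ) 1,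
    (q.1 = 1 ∨ q.2 = 0) → (q'.1 = 1 ∨ q'.2 = 0) → P k m F η q.1 q.2 ∈ Set.Icc vlo vhi → P k m F η
    q'.1 q'.2 ∈ Set.Icc vlo vhi → |Dρ k m F η q| ≤ Λ * |Dρ k m F η q'|) → (∀ k : ℕ, k = 2 ∨ k = 3 →
    ∀ (m : ℕ) (F : Fin m → Quad (Set.univ : Set ℂ)), 0 < m → ∀ vlo vhi : ℝ, 0 < vlo → vlo < vhi →
    vhi < 1 → ∃ Λ η₁ : ℝ, 0 < η₁ ∧ ∀ η ∈ Set.Ioo 0 η₁, ∀ c ∈ Set.Icc (0 : ℝ) 1, ∀ c' ∈ Set.Icc (0 :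
    ℝ) 1, P k m F η 0 c ∈ Set.Icc vlo vhi → P k m F η 0 c' ∈ Set.Icc vlo vhi → Dc k m F η (0, c) ≤ Λ
    * Dc k m F η (0, c')) → GradientComparability := by
  intro hMR hSB hIB hCB hCP hK0
  rw [gradientComparability_iff]
  intro k hk γ hγ m F hm
  obtain ⟨δ, Λ, η₀, hδ, hδ', hη₀, hch⟩ :=
    monotoneLine_charts (hSB hMR)
      (fun k hk γ hγ m F hm => ⟨levelSetTransport_bulk_of_intBet hIB k hk γ hγ m F hm,
        levelSetTransport_corner hCB hCP k hk γ hγ m F hm⟩) hCP hK0 k hk γ hγ m F hm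
  set L : ℝ := max Λ 1 * max Λ 1 with hL
  have hcomp : ∀ s s' : unitInterval, ∀ η ∈ Set.Ioo 0 η₀,
      |Dρ k m F η (γ s)| + |Dc k m F η (γ s)| ≤ L * (|Dρ k m F η (γ s')| + |Dc k m F η (γ s')|) :=
    fun s s' η hη =>
      MonotoneLine.overlap hγ.1 (by rw [hγ.2.1]) (by rw [hγ.2.2.1])
        (G := fun s => |Dρ k m F η (γ s)| + |Dc k m F η (γ s)|)
        (fun _ => add_nonneg (abs_nonneg _) (abs_nonneg _)) hδ hδ' (fun a b => hch a b η hη) s s'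
  refine ⟨L, η₀, hη₀, hcomp, fun N => ?_⟩
  obtain ⟨η₁, hη₁, hdiv⟩ := divergesAt_zero_half k hk m F hm (L * max N 0)
  refine ⟨min η₀ η₁, lt_min hη₀ hη₁, fun η hη s => ?_⟩
  have hend : γ 1 = ((0 : ℝ), (1 / 2 : ℝ)) := hγ.2.2.1
  have h1 := hcomp 1 s η ⟨hη.1, lt_of_lt_of_le hη.2 (min_le_left _ _)⟩
  rw [hend] at h1
  have h2 := hdiv η ⟨hη.1, lt_of_lt_of_le hη.2 (min_le_right _ _)⟩
  have hLpos : 0 < L := by positivity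
  exact (le_max_left N 0).trans (le_of_mul_le_mul_left (h2.trans h1) hLpos)

end Summit.CriticalPhenomena.CardyFormulaZ2.Theorems.CardySelfRefinement

end
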